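import Mathlib
import Literature.Computability.AlgebraicComplexity.GateQuotients

/-!
# Crux `WordLengthQP` (stmt-ValiantsHypothesis-6623), line `Sketch` (eps-order-ladder) —
stub `stub_wordSLP`: affine elementary words are width-3 algebraic branching programs

The `(0,2)` entry of a product `T₁ ⋯ T_ℓ` of affine elementary letters
`T = Matrix.transvection i j (C λ * (1 | X v))` over `MvPolynomial σ ℂ` is a line value of a
straight-line program (`DepthReduction.SLP` certificate: lines `a • u + b • v` / `u * v`,
Bürgisser 2000, Def. 2.1) of length `2ℓ + 1`.  Row `0` of the running product,
`r_t = row 0 (T₁ ⋯ T_t)`, obeys `(r_{t+1})_j = (r_t)_j + c · (r_t)_i`, the other coordinates being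
unchanged (`Matrix.mul_transvection_apply_same / _of_ne`), so per letter one product line
`(1 | x_v) * (r_t)_i` and one linear line `(r_t)_j + λ • (that)` suffice, a pointer table recording
which earlier line (or constant) holds each of the three coordinates (`wordSLP_aux`, by induction on
the word from the right, appending two lines per letter); one final copy line outputs `(r_ℓ)_2`
(`stub_wordSLP`).  No definition is introduced: lines, values and pointers are existential
witnesses, and only the local equations of the certificate are verified.
Source: Bringmann–Ikenmeyer–Zuiddam, *On algebraic branching programs of small width*,
J. ACM 65 (2018) art. 32 (= CCC 2017, arXiv:1702.05328), §3 (words in elementary matrices as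
branching programs); Bürgisser, *Completeness and Reduction in Algebraic Complexity Theory*
(2000), Def. 2.1.
-/

-- `Summit.ValiantsHypothesis.ValiantsHypothesis.…` is the tree's mandated single-conjunct layout
-- (Sub = Summit), so the duplicated namespace component is intended.
set_option linter.dupNamespace false

noncomputable section

open MvPolynomial

namespace Summit.ValiantsHypothesis.ValiantsHypothesis.Cruxes.WordLengthQP.EpsOrderLadder

open Literature.Computability.AlgebraicComplexity.DepthReduction

variable {σ : Type}

/-- The value of an operand at line `n` only depends on the values of the lines before `n`
(Bürgisser 2000, Def. 2.1). -/
theorem sOperand_evalAt_congr (u : SOperand ℂ σ) {val val' : ℕ → MvPolynomial σ ℂ} {n : ℕ}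
    (h : ∀ j < n, val' j = val j) : u.evalAt val' n = u.evalAt val n := by
  cases u with
  | var j => rfl
  | const c => rfl
  | ref j =>
    simp only [SOperand.evalAt]
    split_ifs with hj
    · exact h j hj
    · rfl

/-- The value of a line at position `n` only depends on the values of the lines before `n`
(Bürgisser 2000, Def. 2.1). -/
theorem sLine_evalAt_congr (l : SLine ℂ σ) {val val' : ℕ → MvPolynomial σ ℂ} {n : ℕ}
    (h : ∀ j < n, val' j = val j) : l.evalAt val' n = l.evalAt val n := by
  cases l <;> simp only [SLine.evalAt, sOperand_evalAt_congr _ h]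

/-- **Words are width-3 branching programs** (BIZ18 §3): for a word `w` of affine elementary
letters there are `2|w|` straight-line program lines with their values (local equations hold)
and a pointer table `ptr : Fin 3 → operand` which, read at any line `≥ 2|w|` of ANY program
extending these lines, evaluates to row `0` of the product of the word. -/
theorem wordSLP_aux (w : List (Fin 3 × Fin 3 × ℂ × Option σ)) :
    ∃ (line : ℕ → SLine ℂ σ) (val : ℕ → MvPolynomial σ ℂ) (ptr : Fin 3 → SOperand ℂ σ),
      (∀ n < 2 * w.length, val n = (line n).evalAt val n) ∧
      ∀ val' : ℕ → MvPolynomial σ ℂ, (∀ n < 2 * w.length, val' n = val n) →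
        ∀ (k : Fin 3) (n : ℕ), 2 * w.length ≤ n → (ptr k).evalAt val' n =
          (w.map (fun l => Matrix.transvection l.1 l.2.1
            (MvPolynomial.C l.2.2.1 * l.2.2.2.elim 1 MvPolynomial.X))).prod (0 : Fin 3) k := by
  induction w using List.reverseRecOn with
  | nil =>
    refine ⟨fun _ => .mul (.const 0) (.const 0), fun _ => 0,
      fun k => if k = 0 then .const 1 else .const 0, fun n hn => absurd hn (by simp), ?_⟩
    intro val' _ k n _
    by_cases hk : k = 0
    · subst hk
      simp [SOperand.evalAt]
    · simp [SOperand.evalAt, hk, Ne.symm hk]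
  | append_singleton w a ih =>
    obtain ⟨line, val, ptr, h1, h2⟩ := ih
    obtain ⟨i, j, c, o⟩ := a
    set P := (w.map (fun l => Matrix.transvection l.1 l.2.1
      (MvPolynomial.C l.2.2.1 * l.2.2.2.elim 1 MvPolynomial.X))).prod with hP
    -- the operand `1 | x_v` of the new letter and its value
    have hoper : ∀ (vl : ℕ → MvPolynomial σ ℂ) (m : ℕ),
        (o.elim (.const 1) .var : SOperand ℂ σ).evalAt vl m = o.elim 1 X := by
      intro vl m
      cases o <;> simp [SOperand.evalAt]
    -- values of the extended program: the old ones, then `(1 | x_v) * r_i`, then the new `r_j`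
    obtain ⟨val', hv⟩ : ∃ val' : ℕ → MvPolynomial σ ℂ, ∀ n, val' n =
        if n < 2 * w.length then val n else if n = 2 * w.length then o.elim 1 X * P 0 i
          else P 0 j + MvPolynomial.C c * o.elim 1 X * P 0 i := ⟨_, fun n => rfl⟩
    have hagree : ∀ m < 2 * w.length, val' m = val m := fun m hm => by rw [hv, if_pos hm]
    have hvL : val' (2 * w.length) = o.elim 1 X * P 0 i := by
      rw [hv, if_neg (lt_irrefl _), if_pos rfl]
    have hvL1 : val' (2 * w.length + 1) = P 0 j + MvPolynomial.C c * o.elim 1 X * P 0 i := by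
      rw [hv, if_neg (by omega), if_neg (by omega)]
    refine ⟨fun n => if n < 2 * w.length then line n else if n = 2 * w.length then
          .mul (o.elim (.const 1) .var) (ptr i) else .lin 1 (ptr j) c (.ref (2 * w.length)),
        val', fun k => if k = j then .ref (2 * w.length + 1) else ptr k, ?_, ?_⟩
    · -- local equations of the two new lines (and of the old ones, by congruence)
      intro n hn
      rw [List.length_append, List.length_singleton] at hn
      rcases Nat.lt_trichotomy n (2 * w.length) with hlt | rfl | hgt
      · dsimp only
        rw [if_pos hlt, hagree n hlt, h1 n hlt]
        exact (sLine_evalAt_congr (line n) (fun m hm => hagree m (by omega))).symm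
      · dsimp only
        rw [if_neg (lt_irrefl _), if_pos rfl, hvL, SLine.evalAt, hoper,
          h2 _ hagree i (2 * w.length) le_rfl]
      · obtain rfl : n = 2 * w.length + 1 := by omega
        dsimp only
        rw [if_neg (by omega), if_neg (by omega), hvL1, SLine.evalAt,
          h2 _ hagree j (2 * w.length + 1) (by omega), SOperand.evalAt, if_pos (by omega), hvL,
          one_smul, MvPolynomial.smul_eq_C_mul, mul_assoc]
    · -- the pointer invariant after the new letter
      intro val'' hval'' k n hn
      rw [List.length_append, List.length_singleton] at hn hval''
      rw [List.map_append, List.map_singleton, List.prod_append, List.prod_singleton, ← hP]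
      by_cases hk : k = j
      · subst hk
        dsimp only
        rw [if_pos rfl, SOperand.evalAt, if_pos (by omega), hval'' _ (by omega), hvL1,
          Matrix.mul_transvection_apply_same, mul_assoc]
      · dsimp only
        rw [if_neg hk, Matrix.mul_transvection_apply_of_ne _ _ _ _ hk]
        exact h2 _ (fun m hm => by rw [hval'' m (by omega), hagree m hm]) k n (by omega)

/-- **stub_wordSLP** (words are width-3 ABPs): the `(0,2)` entry of a product of affine
elementary letters `E_ij(λ)`, `E_ij(λ x_v)` of length `ℓ` is a line value of a straight-line
program (`DepthReduction.SLP` certificate, lines `a•u + b•v` / `u*v`) of length `≤ 2ℓ + 1`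
(row `0` of the running product: per letter one product line `x_v * r_i` and one linear line
`r_j + λ t`; one final copy line). -/
theorem stub_wordSLP :
    ∀ {σ : Type} (w : List (Fin 3 × Fin 3 × ℂ × Option σ)),
      ∃ S : Literature.Computability.AlgebraicComplexity.DepthReduction.SLP ℂ σ,
        S.len ≤ 2 * w.length + 1 ∧ ∃ i : ℕ, i < S.len ∧
          S.val i = (w.map (fun l => Matrix.transvection l.1 l.2.1
            (MvPolynomial.C l.2.2.1 * l.2.2.2.elim 1 MvPolynomial.X))).prod (0 : Fin 3) 2 := by
  intro σ w
  obtain ⟨line, val, ptr, h1, h2⟩ := wordSLP_aux w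
  set P := (w.map (fun l => Matrix.transvection l.1 l.2.1
    (MvPolynomial.C l.2.2.1 * l.2.2.2.elim 1 MvPolynomial.X))).prod
  -- the values of the final program: the `2|w|` values of `wordSLP_aux`, then the copy `r_2`
  obtain ⟨val', hv⟩ : ∃ val' : ℕ → MvPolynomial σ ℂ, ∀ n, val' n =
      if n < 2 * w.length then val n else P 0 2 := ⟨_, fun n => rfl⟩
  have hagree : ∀ m < 2 * w.length, val' m = val m := fun m hm => by rw [hv, if_pos hm]
  have hvL : val' (2 * w.length) = P 0 2 := by rw [hv, if_neg (lt_irrefl _)]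
  -- local equations: the old lines by congruence, the copy line by the pointer invariant
  have hvaleq : ∀ n < 2 * w.length + 1, val' n = SLine.evalAt val' n
      ((fun n => if n < 2 * w.length then line n else .lin 1 (ptr 2) 0 (.const 0)) n) := by
    intro n hn
    dsimp only
    rcases Nat.lt_or_ge n (2 * w.length) with hlt | hge
    · rw [if_pos hlt, hagree n hlt, h1 n hlt]
      exact (sLine_evalAt_congr (line n) (fun m hm => hagree m (by omega))).symm
    · obtain rfl : n = 2 * w.length := by omega
      rw [if_neg (lt_irrefl _), hvL, SLine.evalAt, h2 _ hagree 2 (2 * w.length) le_rfl]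
      simp [SOperand.evalAt]
  exact ⟨⟨2 * w.length + 1,
      fun n => if n < 2 * w.length then line n else .lin 1 (ptr 2) 0 (.const 0), val', hvaleq⟩,
    le_rfl, 2 * w.length, Nat.lt_add_one _, hvL⟩

end Summit.ValiantsHypothesis.ValiantsHypothesis.Cruxes.WordLengthQP.EpsOrderLadder

end
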